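import Summits.BirchSwinnertonDyer.BirchSwinnertonDyer.Theorems.GenusKolyvaginAtTwoMinimalTwinBSDTwoTwinShaAnnihilationSignFree
import Summits.BirchSwinnertonDyer.BirchSwinnertonDyer.Theorems.GenusKolyvaginAtTwoGenusDeepSupplyAtTwoNegDiscNarrowKFourCellHalvingDescent
import HarnessLib

/-!
# Route `GenusKolyvaginAtTwo`, crux U₂ `MinimalTwinBSDTwo` (stmt-BirchSwinnertonDyer-22985), LINE 23 «twin_swap» — THE SWAPPED HALVING DESCENT
# (B2Q♭⁻±): a Selmer class of the TWIN of order `2^{M₀}` PRODUCES a transposition-deep Kolyvagin PRIME witness `P(ℓ) ∉ 2W(K[ℓ])` for the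
# root-number `−1` member, either sign of `Δ`, modulo Q2

Seat `bsd-line-gk2-p2` g32 (PROVER seat 2/3, cell `bsd-f1-sign2`, LINE 23 holder), `--supports stmt-BirchSwinnertonDyer-22985 --as helper`.
THEOREMS ONLY (no definition, no named fact, no `sorry`).  BSD is NOT proved by this; U₂ is NOT proved; nothing is closed.

WHAT.  The `ε = −1` mirror of gk2-p5 g36's halving descent B2Q♭ (`PlusDescent.exists_primitive_of_two_pow_pred_smul_ne_zero_of_nonPhantom_of_pairSupply`,
the engine behind the CLOSED depth-one item `K4NegDepthOneOnCut`, 33814): this seat's sign-free swapped engine B2Q⁻± (g31,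
`two_pow_smul_selmer_twist_rat_eq_zero_signFree`) run ONE BIT SHARPER when the regular Kolyvagin prime it produces is NOT a witness.  On the habitat
with `w(W) = −1` (either sign of `Δ`), mod Q2: one `s₀ ∈ Sel_(2^M)(W^{(d_K)}/ℚ)`, `M ≥ M₀+1`, with `2^{M₀−1} • s₀ ≠ 0` yields a Zhang–Kolyvagin
prime `ℓ` of index `≥ M+2` whose Frobenius moves a point of `W[2]` (TRANSPOSITION-deep, the route's `K4Pos` clause) and a `d₁`-compatible datum of
conductor `1·ℓ` with `P(1·ℓ) ∉ 2W(K[1·ℓ])`.  Mechanism: the pair-Čebotarev prime of B2Q⁻± at level `2^{M+2}`; if `P(ℓ) = 2Q` the HALF-POINT class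
`x′` (`ι_M x′ = c_{M+1}(ℓ)`, gk2-p5 g36) is `τ`-ANTI-invariant, so it descends to the TWIN; its descent `u′` is Selmer off `ℓ` and at `∞` (twin descents
at level `M+1` with margin from `M+2`, level invariance, naturality) with threshold `κ+1` at `v_ℓ`; McCallum 5.3 for the twin at a regular prime then
kills one more bit of `s₀`: contradiction.  Consequence (sequel file): at DEPTH ONE a single nonzero class of `Sel(W^{(d_K)}/ℚ)` — a door-CLOSED frame —
needs NO Kolyvagin-conjecture input.  CONDITIONAL on Q2; nothing beyond print is claimed; BSD is NOT proved.

References: [Kolyvagin1989Izv] Thm. B_l, §3; [McCallumLMS1991] §4 Lemma 4.6, §5 Lemma 5.1, Prop. 5.2, Lemma 5.3, Thm. 5.4; [GrossLMS1991] §4 (4.4)–(4.6),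
§5 (5.1); [Kolyvagin1991MathAnn] Thm. 1.
-/

set_option autoImplicit false
-- the Theorems namespace of this sub repeats the summit name by design (D-0017 nested layout)
set_option linter.dupNamespace false

noncomputable section

open scoped Classical
open scoped AddSubgroup

namespace Summit.BirchSwinnertonDyer.BirchSwinnertonDyer.Theorems.GenusExact.TwinSwap.TwinAnnihilation

open WeierstrassCurve NumberField IsDedekindDomain Field Rat.HeightOneSpectrum Literature.NumberTheory.EllipticCurves
  Literature.NumberTheory.GaloisRepresentations Literature.NumberTheory.EllipticCurves.ModularForms AddSubgroup
  Literature.NumberTheory.EllipticCurves.RingClassField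
open Literature.NumberTheory.EllipticCurves.KolyvaginCocycle
open Summit.BirchSwinnertonDyer.BirchSwinnertonDyer.Theses.GenusKolyvaginAtTwo (KolyvaginRelationAtTwo)
open Summit.BirchSwinnertonDyer.Rank1Residual
open Summit.BirchSwinnertonDyer.BirchSwinnertonDyer.Theorems.GenusExact
open Summit.BirchSwinnertonDyer.BirchSwinnertonDyer.Theorems.GenusExact.PlusDescent
open Summit.BirchSwinnertonDyer.BirchSwinnertonDyer.Theorems.GenusExact.TwinGrossPrimes
open Summit.BirchSwinnertonDyer.BirchSwinnertonDyer.Theorems.GenusExact.VisiblePairAtTwo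
  (liesOver_of_natCast_mem natCast_mem_primesEquiv_symm natCast_prime_mem_iff_eq hasGoodReductionAt_of_hasGoodReductionAtPrime
    not_mem_range intCast_notMem_of_not_dvd)
open Summit.BirchSwinnertonDyer.BirchSwinnertonDyer.Theorems.OffBigImageOddLocalAtTwo

/-! ## §1 The swapped halving descent (B2Q♭⁻±) -/

set_option maxHeartbeats 1600000 in -- one long elaboration: the swapped B₂ descent + the half-point descent at three levels
/-- **(B2Q♭⁻±) THE SWAPPED HALVING DESCENT**: on the habitat with `w(W) = −1`, either sign of `Δ`, modulo Q2: one `s₀ ∈ Sel_(2^M)(W^{(d_K)}/ℚ)`,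
`M ≥ M₀ + 1`, with `2^{M₀−1} • s₀ ≠ 0` yields a Zhang–Kolyvagin prime `ℓ` of index `≥ M + 2` with an arithmetic Frobenius that is an involution of
`W[2^{M+2}]`, moves a point of `W[2]` and acts on `K` as a complex conjugation, and a `d₁`-compatible datum of conductor `1·ℓ` whose derived point is
NOT `2`-divisible in `W(K[1·ℓ])`.  See the module docstring.  (Proof = this seat's `two_pow_smul_selmer_twist_rat_eq_zero_signFree` (g31) merged with
gk2-p5 g36's `exists_primitive_of_two_pow_pred_smul_ne_zero_of_nonPhantom_of_pairSupply`; every brick pre-exists.)  CONDITIONAL on Q2; BSD is NOT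
proved by this. [cite: Kolyvagin1989Izv, Thm. B_l (l = 2, A = E^D), §3] [cite: McCallumLMS1991, §4 Lemma 4.6, §5 Lemma 5.3, Thm. 5.4]
[cite: GrossLMS1991, §4 (4.4)–(4.6), §5 (5.1)] -/
theorem exists_transpositionWitness_of_two_pow_pred_smul_selmer_twist_ne_zero_signFree (hQ2 : KolyvaginRelationAtTwo)
    (W : WeierstrassCurve ℚ) [W.IsElliptic] [W.IsGloballyMinimal] [NeZero (W.conductorNorm ℤ)] (hcm : ¬ W.HasCM)
    (hT : Odd W.tamagawaProduct) (v : HeightOneSpectrum (𝓞 ℚ)) (h2v : ((2 : ℕ) : 𝓞 ℚ) ∉ v.asIdeal)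
    (hNv : ((W.conductorNorm ℤ : ℕ) : 𝓞 ℚ) ∈ v.asIdeal) (hmult : W.HasMultiplicativeReductionAt v)
    (K : Type) [Field K] [NumberField K] (hIQ : IsImaginaryQuadratic K) (hodd : Odd (NumberField.discr K))
    (h3 : NumberField.discr K ≠ -3) (hHe : SatisfiesHeegnerHypothesis (W.conductorNorm ℤ) K)
    (hsq1 : ¬ IsSquare ((NumberField.discr K : ℚ) * -|W.Δ|)) (hsq2 : ¬ IsSquare ((NumberField.discr K : ℚ) * (-(2 * |W.Δ|))))
    (hρ : ∀ n : ℕ, 0 < n → W.HasSurjectiveModNGaloisRep ((2 : ℤ) ^ n))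
    (Dt : ModularParametrizationData W (W.conductorNorm ℤ)) (β : ℤ) (ι : K →+* ℂ) (d₁ : KolyvaginHeegnerData Dt β ι 1) (M₀ : ℕ)
    (hndiv : ¬ ∃ Q : (W.baseChange (ringClassField K ι 1)).toAffine.Point, ((2 ^ (M₀ + 1) : ℕ) : ℤ) • Q = d₁.derivedPoint)
    (hw : W.rootNumber = -1)
    [(W.quadraticTwist ((NumberField.discr K : ℤ) : ℚ)).IsElliptic]
    (M : ℕ) (hM₀M : M₀ + 1 ≤ M) (s₀ : galH1Torsion (W.quadraticTwist ((NumberField.discr K : ℤ) : ℚ)) ((2 ^ M : ℕ) : ℤ))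
    (hs₀ : s₀ ∈ selmerGroup (W.quadraticTwist ((NumberField.discr K : ℤ) : ℚ)) ((2 ^ M : ℕ) : ℤ))
    (hne : ((2 ^ (M₀ - 1) : ℕ) : ℤ) • s₀ ≠ 0) :
    ∃ (ℓ : ℕ) (d : KolyvaginHeegnerData Dt β ι (1 * ℓ)),
      Zhang2014.IsKolyvaginPrime (W.conductorNorm ℤ) W K 2 ℓ ∧ M + 2 ≤ Zhang2014.kolyvaginIndex W 2 ℓ ∧
      (∃ (v : HeightOneSpectrum (𝓞 ℚ)) (𝔓 : Ideal (absIntegers (𝓞 ℚ) ℚ)) (h c₀ : absoluteGaloisGroup ℚ),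
          (ℓ : 𝓞 ℚ) ∈ v.asIdeal ∧ 𝔓 ∈ v.primesAbove ∧ IsArithFrobAt (𝓞 ℚ) h 𝔓 ∧ IsComplexConjugation (Rat.castHom ℝ) c₀ ∧
          (∀ X : geomTorsion W ((2 ^ (M + 2) : ℕ) : ℤ), h • h • X = X) ∧
          (∃ u : geomTorsion W ((2 : ℕ) : ℤ), h • u ≠ u) ∧
          ∀ (e : K →ₐ[ℚ] AlgebraicClosure ℚ) (z : K), h • e z = c₀ • e z) ∧
      (∀ s ∈ d₁.S, ∃ s' ∈ d.S, ∀ (x : ringClassField K ι 1) (x' : ringClassField K ι (1 * ℓ)),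
          (x : ℂ) = x' → ((s' x' : ringClassField K ι (1 * ℓ)) : ℂ) = (s x : ℂ)) ∧
      (∀ (x : ringClassField K ι 1) (x' : ringClassField K ι (1 * ℓ)), (x : ℂ) = x' → d.emb x' = d₁.emb x) ∧
      ¬ ∃ Q : (W.baseChange (ringClassField K ι (1 * ℓ))).toAffine.Point, (2 : ℤ) • Q = d.derivedPoint := by
  haveI : Fact (Nat.Prime 2) := ⟨Nat.prime_two⟩
  haveI : ∀ j : ℕ, NumberField (ringClassField K ι j) := JET.numberField_ringClassField K hIQ ι
  haveI hell : (W.baseChange K).IsElliptic := inferInstanceAs ((W.map (algebraMap ℚ K)).IsElliptic)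
  have hM : 1 ≤ M := le_trans (Nat.le_add_left 1 M₀) hM₀M
  have hM' : 1 ≤ M + 1 := by omega
  have hM'' : 1 ≤ M + 1 + 1 := by omega
  have hsurN : ∀ m : ℕ, W.HasSurjectiveModNGaloisRep ((2 ^ m : ℕ) : ℤ) :=
    MinimalTwinBSDTwo.forall_hasSurjectiveModNGaloisRep_two_pow_of_pos W hρ
  have hρN : ∀ m : ℕ, W.HasSurjectiveModNGaloisRep (2 ^ m : ℕ) := fun m ↦ by exact_mod_cast hsurN m
  have hsurj1 : W.HasSurjectiveModNGaloisRep ((2 : ℤ) ^ 1) := hρ 1 one_pos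
  have hs2 : W.HasSurjectiveModNGaloisRep 2 := by simpa using hsurj1
  have h2 : Module.finrank ℚ K = 2 := hIQ.1
  have hN : (W.conductorNorm ℤ) ≠ 0 := NeZero.ne _
  have hD4 : NumberField.discr K ≠ -4 := fun h ↦ by
    rw [h] at hodd; exact (Int.not_even_iff_odd.mpr hodd) ⟨-2, by norm_num⟩
  have hD : NumberField.discr K < -4 := X11b.KolyvaginAssembly.discr_lt_neg_four hIQ ⟨h3, hD4⟩
  have hdK0 : ((NumberField.discr K : ℤ) : ℚ) ≠ 0 := by exact_mod_cast NumberField.discr_ne_zero K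
  obtain ⟨θ, hθ, hd⟩ := Literature.NumberTheory.QuadraticFields.Quadratic.exists_not_mem_range_sq_eq_discr (K := K) h2
  set τ : K ≃ₐ[ℚ] K := sigmaQ K h2 hθ hd with hτdef
  have hτ : τ ≠ 1 := sigmaQ_ne_one K h2 hθ hd
  have htorsK : ∀ (m : ℕ) (P : (W.baseChange K).toAffine.Point), ((2 ^ m : ℕ) : ℤ) • P = 0 → P = 0 := fun m P hP ↦
    EigenClassesFinite.forall_zsmul_two_pow_baseChange_eq_zero_of_hasSurjectiveModNGaloisRep_two W K h2 hs2 m P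
      (by exact_mod_cast hP)
  have hbotK : AddSubgroup.torsionBy (W.baseChange K).toAffine.Point ((2 : ℕ) : ℤ) = ⊥ := by
    rw [eq_bot_iff]
    intro P hP
    rw [AddSubgroup.mem_bot]
    exact htorsK 1 P (by simpa using hP)
  have hNPh : ∀ (L : ℕ), 1 ≤ L → ∀ z : galH1Torsion (W.baseChange K) ((2 ^ L : ℕ) : ℤ),
      (∀ ρ' ∈ torsionFixing (W.baseChange K) ((2 ^ L : ℕ) : ℤ), h1Eval (W.baseChange K) ((2 ^ L : ℕ) : ℤ) z ρ' = 0) →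
      (∀ w : HeightOneSpectrum (𝓞 K), z ∈ selmerLocalKer (W.baseChange K) (w.adicCompletion K) ((2 ^ L : ℕ) : ℤ)) → z = 0 :=
    fun L hL z hz hzS ↦ NonPhantomPow.nonPhantomAtTwo_of_hasMultiplicativeReductionAt (W := W) (K := K) hT hρ hIQ hodd hsq1 hsq2 hN hHe
      h2v hNv hmult L hL z hz (fun w _ ↦ hzS w)
  set s : galH1Torsion (W.baseChange K) ((2 ^ M : ℕ) : ℤ) :=
    hPsiKT W K hθ hd ((2 ^ M : ℕ) : ℤ) (resTorsion (W.quadraticTwist ((NumberField.discr K : ℤ) : ℚ)) K ((2 ^ M : ℕ) : ℤ) s₀) with hsdef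
  have hsSel : s ∈ selmerGroup (W.baseChange K) ((2 ^ M : ℕ) : ℤ) :=
    (hPsiKT_resTorsion_mem_selmerGroup_and_conjAct_eq W K h2 hθ hd ((2 ^ M : ℕ) : ℤ) hs₀).1
  have hτs : conjAct W τ ((2 ^ M : ℕ) : ℤ) s = (-1 : ℤ) • s :=
    (hPsiKT_resTorsion_mem_selmerGroup_and_conjAct_eq W K h2 hθ hd ((2 ^ M : ℕ) : ℤ) hs₀).2
  have hinjψ : ∀ L : ℕ, Function.Injective (fun x : galH1Torsion (W.quadraticTwist ((NumberField.discr K : ℤ) : ℚ)) ((2 ^ L : ℕ) : ℤ) ↦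
      hPsiKT W K hθ hd ((2 ^ L : ℕ) : ℤ) (resTorsion (W.quadraticTwist ((NumberField.discr K : ℤ) : ℚ)) K ((2 ^ L : ℕ) : ℤ) x)) :=
    fun L x₁ x₂ h ↦ (EigenClassesFinite.resTorsion_twist_injective_of_noTorsion W K h2 hθ hd ((2 ^ L : ℕ) : ℤ) (htorsK L))
      ((hPsiKT W K hθ hd ((2 ^ L : ℕ) : ℤ)).injective h)
  obtain ⟨a, haM, ha⟩ := exists_addOrderOf_galH1Torsion_eq_two_pow W K M s
  by_cases ha0 : a = 0
  · -- `s = 0`, hence `s₀ = 0`: contradicts `hne`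
    have hs0 : s = 0 := AddMonoid.addOrderOf_eq_one_iff.mp (by rw [ha, ha0, pow_zero])
    have : s₀ = 0 := hinjψ M (by
      change s = hPsiKT W K hθ hd ((2 ^ M : ℕ) : ℤ) (resTorsion (W.quadraticTwist ((NumberField.discr K : ℤ) : ℚ)) K ((2 ^ M : ℕ) : ℤ) 0)
      rw [hs0, map_zero, map_zero])
    exact (hne (by rw [this, zsmul_zero])).elim
  have ha1 : 1 ≤ a := Nat.one_le_iff_ne_zero.mpr ha0
  have hdiv : ∀ P : geomPoints (W.baseChange K), ∃ Q : geomPoints (W.baseChange K), ((2 ^ M : ℕ) : ℤ) • Q = P :=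
    (W.baseChange K).zsmul_geomPoints_surjective_of_charZero (by positivity)
  set δ := kummerMapTorsion (W.baseChange K) ((2 ^ M : ℕ) : ℤ) hdiv with hδ
  have hker : δ.ker = (zsmulAddGroupHom (α := (W.baseChange K).toAffine.Point) ((2 ^ M : ℕ) : ℤ)).range :=
    kummerMapTorsion_ker (W.baseChange K) ((2 ^ M : ℕ) : ℤ) hdiv
  obtain ⟨Ph, hPh, hPhmap⟩ := AdditiveKoly.exists_isHeegnerPoint_map_eq_derivedPoint_one (W := W) (K := K) (Dt := Dt) (β := β)
    (ι := ι) hIQ hHe d₁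
  set y := d₁.kolyvaginClass Nat.prime_two M with hydef
  have hc1 : y = δ Ph := VisiblePairAtTwo.kolyvaginClass_one_two_eq_kummerMapTorsion W K hIQ hodd hHe hsurj1 M d₁ Ph hPhmap
  have hP₀ : ∀ Q : (W.baseChange K).toAffine.Point, ((2 ^ (M₀ + 1) : ℕ) : ℤ) • Q ≠ Ph :=
    forall_two_pow_smul_ne_bottom_of_not_dvd_derivedPoint d₁ Ph hPhmap le_rfl hndiv
  obtain ⟨κ, hκM, hκ⟩ := exists_addOrderOf_galH1Torsion_eq_two_pow W K M y
  have hκge : M - M₀ ≤ κ := by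
    by_contra hlt'
    have h0 : ((2 ^ κ : ℕ) : ℤ) • y = 0 := (two_pow_zsmul_eq_zero_iff_of_addOrderOf W K hκ κ).mpr le_rfl
    have hmem : ((2 ^ κ : ℕ) : ℤ) • Ph ∈ δ.ker := by rw [AddMonoidHom.mem_ker, map_zsmul, ← hc1, h0]
    rw [hker] at hmem
    obtain ⟨R, hR⟩ := hmem
    have hPhR : Ph = ((2 ^ (M - κ) : ℕ) : ℤ) • R := eq_two_pow_zsmul_of_two_pow_zsmul_eq (htorsK 1 · <| by simpa using ·) hκM hR
    refine hP₀ (((2 ^ (M - κ - (M₀ + 1)) : ℕ) : ℤ) • R) ?_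
    rw [hPhR, smul_smul]
    congr 1
    push_cast
    rw [← pow_add]
    congr 1
    omega
  have hκ1 : 1 ≤ κ := by omega
  have h1K : ∀ q ∈ (1 : ℕ).primeFactors, Zhang2014.IsKolyvaginPrime (W.conductorNorm ℤ) W K 2 q ∧ M ≤ Zhang2014.kolyvaginIndex W 2 q := by
    simp
  obtain ⟨-, hτy⟩ := KolyvaginClassSign.sign_conjAct_kolyvaginClass_two hIQ h3 hD4 hodd hHe hsurj1 τ hτ Dt β ι squarefree_one hM h1K d₁
  rw [Nat.primeFactors_one, Finset.card_empty, pow_zero, mul_one, hw, neg_neg] at hτy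
  have hdvd : ((2 ^ M : ℕ) : ℤ) ∣ ((2 ^ (M + 1) : ℕ) : ℤ) := KolyvaginPairDataTwo.two_pow_dvd_two_pow_succ M
  set ιM := torsionH1OfDvd (W.baseChange K) hdvd with hιM
  have hιinj : Function.Injective ιM := KolyvaginPairDataTwo.torsionH1OfDvd_succ_injective W M hIQ hs2
  have hdvd2 : ((2 ^ M : ℕ) : ℤ) ∣ ((2 ^ (M + 2) : ℕ) : ℤ) := natCast_pow_dvd_natCast_pow (p := 2) (by omega)
  set ι₂ := torsionH1OfDvd (W.baseChange K) hdvd2 with hι₂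
  have hι₂inj : Function.Injective ι₂ := VisiblePairAtTwo.torsionH1OfDvd_pow_injective (W.baseChange K) (p := 2) hbotK hdvd2
  have hsSel' : ι₂ s ∈ selmerGroup (W.baseChange K) ((2 ^ (M + 2) : ℕ) : ℤ) := torsionH1OfDvd_mem_selmerGroup (W.baseChange K) hdvd2 hsSel
  have hySel : y ∈ selmerGroup (W.baseChange K) ((2 ^ M : ℕ) : ℤ) := by
    rw [hc1]; exact WeierstrassCurve.kummerMapTorsion_mem_selmerGroup (W.baseChange K) _ hdiv Ph
  have hySel' : ι₂ y ∈ selmerGroup (W.baseChange K) ((2 ^ (M + 2) : ℕ) : ℤ) := torsionH1OfDvd_mem_selmerGroup (W.baseChange K) hdvd2 hySel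
  have hords' : addOrderOf (ι₂ s) = 2 ^ a := by rw [addOrderOf_injective ι₂ hι₂inj, ha]
  have hordy' : addOrderOf (ι₂ y) = 2 ^ κ := by rw [addOrderOf_injective ι₂ hι₂inj, hκ]
  have hτs' : conjAct W τ ((2 ^ (M + 2) : ℕ) : ℤ) (ι₂ s) = (-1 : ℤ) • ι₂ s := by
    rw [hι₂, conjAct_torsionH1OfDvd W τ hdvd2 s, hτs, map_zsmul]
  have hτy' : conjAct W τ ((2 ^ (M + 2) : ℕ) : ℤ) (ι₂ y) = (1 : ℤ) • ι₂ y := by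
    rw [hι₂, conjAct_torsionH1OfDvd W τ hdvd2 y, hτy, map_zsmul]
  have hres : ∀ a' b' : ℤ, (∀ ρ' ∈ torsionFixing (W.baseChange K) ((2 ^ (M + 2) : ℕ) : ℤ),
      h1Eval (W.baseChange K) ((2 ^ (M + 2) : ℕ) : ℤ) (a' • ι₂ s + b' • ι₂ y) ρ' = 0) → a' • ι₂ s + b' • ι₂ y = 0 := by
    intro a' b' hab
    have hmem : a' • ι₂ s + b' • ι₂ y ∈ selmerGroup (W.baseChange K) ((2 ^ (M + 2) : ℕ) : ℤ) :=
      add_mem (AddSubgroup.zsmul_mem _ hsSel' a') (AddSubgroup.zsmul_mem _ hySel' b')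
    exact hNPh (M + 2) (by omega) _ hab (fun w ↦ (((W.baseChange K).mem_selmerGroup_iff _ _).mp hmem).1 w)
  obtain ⟨ℓ, hkolZ, hidx', hfrob, hloc'⟩ := regularPairSupply_of_heegner W K hIQ hodd hHe hρ (M + 1) τ hτ (ι₂ s) (ι₂ y) a κ ha1 hκ1 hords'
    hordy' (-1) 1 (Or.inr rfl) (Or.inl rfl) hτs' hτy' hres
  have hidx2 : M + 2 ≤ Zhang2014.kolyvaginIndex W 2 ℓ := hidx'
  obtain ⟨hℓp, hℓN, hℓdK, hℓ2, hℓprime, hidxpos⟩ := hkolZ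
  haveI : Fact ℓ.Prime := ⟨hℓp⟩
  have hkolZ : Zhang2014.IsKolyvaginPrime (W.conductorNorm ℤ) W K 2 ℓ := ⟨hℓp, hℓN, hℓdK, hℓ2, hℓprime, hidxpos⟩
  have hidxM : M ≤ Zhang2014.kolyvaginIndex W 2 ℓ := le_trans (by omega) hidx2
  obtain ⟨vP, 𝔓, hfr, c₀, hℓvP, h𝔓, hhfr, hc₀, hhsq, hhu, hhK⟩ := hfrob
  set w : HeightOneSpectrum (𝓞 K) := ⟨Ideal.span {(ℓ : 𝓞 K)}, hℓprime, by
    rw [Ne, Ideal.span_singleton_eq_bot]; exact_mod_cast hℓp.ne_zero⟩ with hwdef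
  have hwℓ : (ℓ : 𝓞 K) ∈ w.asIdeal := Ideal.mem_span_singleton_self _
  set vℓ : HeightOneSpectrum (𝓞 ℚ) := primesEquiv.symm ⟨ℓ, hℓp⟩ with hvℓdef
  have hℓv : (ℓ : 𝓞 ℚ) ∈ vℓ.asIdeal := natCast_mem_primesEquiv_symm hℓp
  have hvPℓ : vP = vℓ := (natCast_prime_mem_iff_eq hℓp vP).mp hℓvP
  obtain ⟨h2vℓ, hqv⟩ := SelmerDescent.two_notMem_and_natCast_two_pow_notMem (rfl : 2 ^ M = 2 ^ M) hℓp hℓ2 hℓv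
  have hdKv : ((NumberField.discr K : ℤ) : 𝓞 ℚ) ∉ vℓ.asIdeal := intCast_notMem_of_not_dvd hℓp hℓv hℓdK
  haveI hLO : w.asIdeal.LiesOver vℓ.asIdeal := liesOver_of_natCast_mem hℓp hℓv hwℓ
  have hgood : W.HasGoodReductionAtPrime ℓ := hasGoodReductionAtPrime_of_not_dvd_conductorNorm W hℓN
  have hgoodv : W.HasGoodReductionAt vℓ := hasGoodReductionAt_of_hasGoodReductionAtPrime W hgood hℓv
  have hgoodK : (W.baseChange K).HasGoodReductionAt w := Engine.hasGoodReductionAt_baseChange_of_rat W hℓp hℓv hgoodv hwℓ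
  have hf : w.asIdeal.inertiaDeg (𝓞 ℚ) = 2 :=
    Summit.BirchSwinnertonDyer.Rank1Residual.X11b.Three.Koly.Method2.LocalFrob.inertiaDeg_eq_two_of_isPrime_span K h2 hℓp hℓprime w hwℓ
  have hfrob' : ∃ (v' : HeightOneSpectrum (𝓞 ℚ)) (𝔓' : Ideal (absIntegers (𝓞 ℚ) ℚ)) (h' : absoluteGaloisGroup ℚ),
      (ℓ : 𝓞 ℚ) ∈ v'.asIdeal ∧ 𝔓' ∈ v'.primesAbove ∧ IsArithFrobAt (𝓞 ℚ) h' 𝔓' ∧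
      (∀ P : geomTorsion W ((2 ^ (M + 2) : ℕ) : ℤ), h' • P = hfr • P) ∧
      ∀ (e : K →ₐ[ℚ] AlgebraicClosure ℚ) (z : K), h' • e z = c₀ • e z :=
    ⟨vP, 𝔓, hfr, hℓvP, h𝔓, hhfr, fun _ ↦ rfl, hhK⟩
  have h𝔓ℓ : 𝔓 ∈ vℓ.primesAbove := hvPℓ ▸ h𝔓
  have hreg2 : ∃ (𝔓' : Ideal (absIntegers (𝓞 ℚ) ℚ)) (h' : absoluteGaloisGroup ℚ), 𝔓' ∈ vℓ.primesAbove ∧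
      IsArithFrobAt (𝓞 ℚ) h' 𝔓' ∧ (∀ P : geomTorsion W ((2 : ℕ) : ℤ), h' • h' • P = P) ∧
      ∃ u : geomTorsion W ((2 : ℕ) : ℤ), h' • u ≠ u :=
    ⟨𝔓, hfr, h𝔓ℓ, hhfr, smul_smul_eq_self_of_dvd W (by exact_mod_cast dvd_pow_self 2 (Nat.succ_ne_zero (M + 1))) hhsq, hhu⟩
  have hregM : ∃ (𝔓' : Ideal (absIntegers (𝓞 ℚ) ℚ)) (h' : absoluteGaloisGroup ℚ), 𝔓' ∈ vℓ.primesAbove ∧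
      IsArithFrobAt (𝓞 ℚ) h' 𝔓' ∧ (∀ X : geomTorsion W ((2 ^ M : ℕ) : ℤ), h' • h' • X = X) ∧
      ∃ u : geomTorsion W 2, h' • u ≠ u :=
    ⟨𝔓, hfr, h𝔓ℓ, hhfr, smul_smul_eq_self_of_dvd W hdvd2 hhsq, exists_smul_ne_two_of_natCast W hhu⟩
  have h1T : (1 : VariableChange ℚ) • W.quadraticTwist ((NumberField.discr K : ℤ) : ℚ) = (W.quadraticTwist ((NumberField.discr K : ℤ) : ℚ)) :=
    one_smul _ _
  have hgoodT : (W.quadraticTwist ((NumberField.discr K : ℤ) : ℚ)).HasGoodReductionAtPrime ℓ :=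
    hasGoodReductionAtPrime_of_smul_quadraticTwist_eq W h2 hodd (W.quadraticTwist ((NumberField.discr K : ℤ) : ℚ)) h1T hℓdK hgood
  have hgoodTv : (W.quadraticTwist ((NumberField.discr K : ℤ) : ℚ)).HasGoodReductionAt vℓ :=
    hasGoodReductionAt_of_hasGoodReductionAtPrime (W.quadraticTwist ((NumberField.discr K : ℤ) : ℚ)) hgoodT hℓv
  have hregMT : ∃ (𝔓' : Ideal (absIntegers (𝓞 ℚ) ℚ)) (h' : absoluteGaloisGroup ℚ), 𝔓' ∈ vℓ.primesAbove ∧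
      IsArithFrobAt (𝓞 ℚ) h' 𝔓' ∧ (∀ X : geomTorsion (W.quadraticTwist ((NumberField.discr K : ℤ) : ℚ)) ((2 ^ M : ℕ) : ℤ), h' • h' • X = X) ∧
      ∃ u : geomTorsion (W.quadraticTwist ((NumberField.discr K : ℤ) : ℚ)) 2, h' • u ≠ u :=
    Engine.regularFrobDatum_of_smul_quadraticTwist_eq W (W.quadraticTwist ((NumberField.discr K : ℤ) : ℚ)) hdK0 h1T hregM
  obtain ⟨hαs', hαy'⟩ := hloc' w hwℓ
  have hmw : ((((2 ^ (M + 2) : ℕ) : ℕ) : ℤ) : 𝓞 K) ∉ w.asIdeal := fun hm ↦ by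
    apply not_natCast_mem_of_prime_ne hℓp Nat.prime_two hℓ2 w hwℓ
    rw [Int.cast_natCast, Nat.cast_pow] at hm
    exact w.isPrime.mem_of_pow_mem _ hm
  haveI : NeZero (2 ^ (M + 2)) := ⟨pow_ne_zero _ two_ne_zero⟩
  have htriv : ∀ (g : absoluteGaloisGroup (w.adicCompletion K)) (Q : geomTorsion (W.baseChange K) ((2 ^ (M + 2) : ℕ) : ℤ)),
      resGal (K := K) (w.adicCompletion K) g • Q = Q := fun g Q ↦
    Engine.absGaloisRestrict_smul_geomTorsion_eq_regular W hIQ hc₀ hhsq hℓp hℓprime hfrob' hwℓ hgoodK hmw g Q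
  have htrans : ∀ x : galH1Torsion (W.baseChange K) ((2 ^ M : ℕ) : ℤ),
      x ∈ (W.baseChange K).torsionLocalKer (w.adicCompletion K) ((2 ^ M : ℕ) : ℤ) ↔
      ι₂ x ∈ (W.baseChange K).torsionLocalKer (w.adicCompletion K) ((2 ^ (M + 2) : ℕ) : ℤ) := fun x ↦
    mem_torsionLocalKer_iff_torsionH1OfDvd_mem (W.baseChange K) (w.adicCompletion K) (pow_dvd_pow 2 (by omega : M ≤ M + 2))
      (pow_ne_zero _ two_ne_zero) (pow_ne_zero _ two_ne_zero) htriv x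
  have hαs : ∀ j : ℕ, ((2 ^ j : ℕ) : ℤ) • s ∈ (W.baseChange K).torsionLocalKer (w.adicCompletion K) ((2 ^ M : ℕ) : ℤ) ↔ a ≤ j :=
    fun j ↦ by rw [htrans, map_zsmul]; exact hαs' j
  have hαy : ∀ j : ℕ, ((2 ^ j : ℕ) : ℤ) • y ∈ (W.baseChange K).torsionLocalKer (w.adicCompletion K) ((2 ^ M : ℕ) : ℤ) ↔ κ ≤ j :=
    fun j ↦ by rw [htrans, map_zsmul]; exact hαy' j
  obtain ⟨dℓ, hdℓ⟩ := JET.exists_compatible_data_of_grossCM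
    (phi_heegnerPointOfConductor_mem_range_map_ringClassField_holds (W.conductorNorm ℤ) W K) hIQ hD hHe 2 Dt β ι
    squarefree_one (by simp) d₁
  have hℓ1 : ℓ ∉ (1 : ℕ).primeFactors := by simp
  obtain ⟨hσ', hS', hS'', hemb'⟩ := hdℓ ℓ hkolZ hℓ1
  set d' := dℓ ℓ hkolZ hℓ1 with hd'_def
  set x := d'.kolyvaginClass Nat.prime_two M with hx_def
  have hc' : Squarefree (1 * ℓ) := by rw [one_mul]; exact hℓp.squarefree
  have hℓn : ¬ ℓ ∣ 1 := fun h ↦ hℓp.one_lt.ne' (Nat.dvd_one.mp h)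
  have hkM2 : ∀ q ∈ (1 * ℓ).primeFactors, Zhang2014.IsKolyvaginPrime (W.conductorNorm ℤ) W K 2 q ∧
      M + 1 + 1 ≤ Zhang2014.kolyvaginIndex W 2 q := by
    intro q hq
    rw [one_mul, hℓp.primeFactors, Finset.mem_singleton] at hq
    subst hq
    exact ⟨hkolZ, hidx2⟩
  have hkM1 : ∀ q ∈ (1 * ℓ).primeFactors, Zhang2014.IsKolyvaginPrime (W.conductorNorm ℤ) W K 2 q ∧
      M + 1 ≤ Zhang2014.kolyvaginIndex W 2 q := fun q hq ↦ ⟨(hkM2 q hq).1, le_trans (Nat.le_succ _) (hkM2 q hq).2⟩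
  have hkM : ∀ q ∈ (1 * ℓ).primeFactors, Zhang2014.IsKolyvaginPrime (W.conductorNorm ℤ) W K 2 q ∧ M ≤ Zhang2014.kolyvaginIndex W 2 q :=
    fun q hq ↦ ⟨(hkM2 q hq).1, le_trans (by omega) (hkM2 q hq).2⟩
  have hcard : (1 * ℓ).primeFactors.card = 1 := by rw [one_mul, hℓp.primeFactors, Finset.card_singleton]
  obtain ⟨-, hx⟩ := KolyvaginClassSign.sign_conjAct_kolyvaginClass_two hIQ h3 hD4 hodd hHe hsurj1 τ hτ Dt β ι hc' hM hkM d'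
  obtain ⟨-, hx1⟩ := KolyvaginClassSign.sign_conjAct_kolyvaginClass_two hIQ h3 hD4 hodd hHe hsurj1 τ hτ Dt β ι hc' hM' hkM1 d'
  obtain ⟨-, hx2⟩ := KolyvaginClassSign.sign_conjAct_kolyvaginClass_two hIQ h3 hD4 hodd hHe hsurj1 τ hτ Dt β ι hc' hM'' hkM2 d'
  rw [hcard, pow_one, hw, neg_neg] at hx hx1 hx2
  have hxneg : conjAct W τ ((2 ^ M : ℕ) : ℤ) x = -x := by
    rw [hx_def, hx, show ((1 : ℤ) * -1) = -1 by norm_num, neg_one_zsmul]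
  have hx1neg : conjAct W τ ((2 ^ (M + 1) : ℕ) : ℤ) (d'.kolyvaginClass Nat.prime_two (M + 1)) =
      -d'.kolyvaginClass Nat.prime_two (M + 1) := by
    rw [hx1, show ((1 : ℤ) * -1) = -1 by norm_num, neg_one_zsmul]
  have hx2neg : conjAct W τ ((2 ^ (M + 1 + 1) : ℕ) : ℤ) (d'.kolyvaginClass Nat.prime_two (M + 1 + 1)) =
      -d'.kolyvaginClass Nat.prime_two (M + 1 + 1) := by
    rw [hx2, show ((1 : ℤ) * -1) = -1 by norm_num, neg_one_zsmul]
  have hQ := hQ2 W hcm K hIQ h3 hD4 hHe hρN Dt β ι M hM 1 ℓ hc' hℓp hℓn hkM d₁ d' hσ' hS' hS'' hemb' w hwℓ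
  have hβ : ∀ j : ℕ, ((2 ^ j : ℕ) : ℤ) • x ∈ selmerLocalKer (W.baseChange K) (w.adicCompletion K) ((2 ^ M : ℕ) : ℤ) ↔ κ ≤ j :=
    fun j ↦ (hQ j).1.trans (((hQ j).2).trans (hαy j))
  have haway : ∀ v' : HeightOneSpectrum (𝓞 ℚ), v' ≠ vℓ →
      ∀ w' : HeightOneSpectrum (𝓞 K), w'.asIdeal.LiesOver v'.asIdeal → ((1 * ℓ : ℕ) : 𝓞 K) ∉ w'.asIdeal := by
    intro v' hv' w' hw' hmem
    rw [one_mul] at hmem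
    have hvmem : (ℓ : 𝓞 ℚ) ∈ v'.asIdeal := by
      have h : algebraMap (𝓞 ℚ) (𝓞 K) (ℓ : 𝓞 ℚ) ∈ w'.asIdeal := by rwa [map_natCast]
      rw [← Ideal.mem_comap, ← Ideal.under_def, ← Ideal.LiesOver.over (P := w'.asIdeal) (p := v'.asIdeal)] at h
      exact h
    exact hv' ((natCast_prime_mem_iff_eq hℓp v').mp hvmem)
  obtain ⟨u, hu, -⟩ := EigenClassesFinite.existsUnique_hPsiKT_resTorsion_eq_of_conjAct_eq_neg W K h2 hθ hd ((2 ^ M : ℕ) : ℤ) (htorsK M) hxneg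
  have hudv : ((2 : ℤ) ^ (κ - 1)) • u ∉ selmerLocalKer (W.quadraticTwist ((NumberField.discr K : ℤ) : ℚ)) (vℓ.adicCompletion ℚ) ((2 ^ M : ℕ) : ℤ) := by
    intro hmem
    have h' : ((2 : ℤ) ^ (κ - 1)) • resTorsion (W.quadraticTwist ((NumberField.discr K : ℤ) : ℚ)) K ((2 ^ M : ℕ) : ℤ) u ∈
        selmerLocalKer ((W.quadraticTwist ((NumberField.discr K : ℤ) : ℚ)).baseChange K) (w.adicCompletion K) ((2 ^ M : ℕ) : ℤ) :=
      (SelmerDescent.zsmul_mem_selmerLocalKer_iff_resTorsion (W.quadraticTwist ((NumberField.discr K : ℤ) : ℚ)) h2 (not_mem_range hθ) hd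
        ((2 ^ M : ℕ) : ℤ) vℓ w hgoodTv hqv h2vℓ hdKv u _).mp hmem
    have h'' : ((2 : ℤ) ^ (κ - 1)) • x ∈ selmerLocalKer (W.baseChange K) (w.adicCompletion K) ((2 ^ M : ℕ) : ℤ) := by
      rw [← hu]
      exact (EigenClassesFinite.zsmul_mem_selmerLocalKer_iff_hPsiKT_mem W K hθ hd ((2 ^ M : ℕ) : ℤ) (w.adicCompletion K) _ _).mp h'
    have h''' : ((2 ^ (κ - 1) : ℕ) : ℤ) • x ∈ selmerLocalKer (W.baseChange K) (w.adicCompletion K) ((2 ^ M : ℕ) : ℤ) := by exact_mod_cast h''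
    have := (hβ (κ - 1)).mp h'''
    omega
  -- ### THE DICHOTOMY: either `(ℓ, d')` is a witness — done — or `P(1·ℓ) = 2·Q` and we halve
  by_cases hwit : ∃ Q : (W.baseChange (ringClassField K ι (1 * ℓ))).toAffine.Point, (2 : ℤ) • Q = d'.derivedPoint
  swap
  · exact ⟨ℓ, d', hkolZ, hidx2, ⟨vP, 𝔓, hfr, c₀, hℓvP, h𝔓, hhfr, hc₀, hhsq, hhu, hhK⟩, hS', hemb', hwit⟩
  exfalso
  obtain ⟨Qh, hQh⟩ := hwit
  have hA1 : IsAdmissible (absoluteGaloisGroup K) d'.pointsSubgroup ((2 ^ (M + 1) : ℕ) : ℤ) :=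
    isAdmissible_pointsSubgroup_two_of_heegner d' hIQ hc'.ne_zero hD4 hHe hρN (M + 1)
  have hP1 : d'.toGeomPoints d'.derivedPoint ∈ invPoints (absoluteGaloisGroup K) d'.pointsSubgroup ((2 ^ (M + 1) : ℕ) : ℤ) :=
    Prop44.toGeomPoints_derivedPoint_mem_invPoints hIQ ι hD hHe Dt Nat.prime_two hc' hkM1 d'
  obtain ⟨x', hx'⟩ : ∃ x' : galH1Torsion (W.baseChange K) ((2 ^ M : ℕ) : ℤ), ιM x' = d'.kolyvaginClass Nat.prime_two (M + 1) :=
    exists_torsionH1OfDvd_eq_kolyvaginClass_succ_of_two_zsmul_eq d' hA1 hP1 hQh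
  have hlev : ιM x = (2 : ℤ) • d'.kolyvaginClass Nat.prime_two (M + 1) := by
    have h := torsionH1OfDvd_kolyvaginClass_pow d' Nat.prime_two (Nat.le_succ M) hA1 hP1
    rw [show M + 1 - M = 1 from by omega, pow_one] at h
    exact_mod_cast h
  have h2x' : (2 : ℤ) • x' = x := hιinj (by rw [map_zsmul, hx', ← hlev])
  have hτx' : conjAct W τ ((2 ^ M : ℕ) : ℤ) x' = -x' := by
    apply hιinj
    rw [map_neg, hιM, ← conjAct_torsionH1OfDvd W τ hdvd x']
    change conjAct W τ ((2 ^ (M + 1) : ℕ) : ℤ) (ιM x') = -ιM x'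
    rw [hx', hx1neg]
  obtain ⟨u1, hu1, -⟩ := EigenClassesFinite.existsUnique_hPsiKT_resTorsion_eq_of_conjAct_eq_neg W K h2 hθ hd ((2 ^ (M + 1) : ℕ) : ℤ)
    (htorsK (M + 1)) hx1neg
  obtain ⟨u', hu', -⟩ := EigenClassesFinite.existsUnique_hPsiKT_resTorsion_eq_of_conjAct_eq_neg W K h2 hθ hd ((2 ^ M : ℕ) : ℤ) (htorsK M) hτx'
  have hιu' : torsionH1OfDvd (W.quadraticTwist ((NumberField.discr K : ℤ) : ℚ)) hdvd u' = u1 := by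
    apply hinjψ (M + 1)
    change hPsiKT W K hθ hd ((2 ^ (M + 1) : ℕ) : ℤ) (resTorsion (W.quadraticTwist ((NumberField.discr K : ℤ) : ℚ)) K ((2 ^ (M + 1) : ℕ) : ℤ)
        (torsionH1OfDvd (W.quadraticTwist ((NumberField.discr K : ℤ) : ℚ)) hdvd u')) =
      hPsiKT W K hθ hd ((2 ^ (M + 1) : ℕ) : ℤ) (resTorsion (W.quadraticTwist ((NumberField.discr K : ℤ) : ℚ)) K ((2 ^ (M + 1) : ℕ) : ℤ) u1)
    rw [SelmerDescent.resTorsion_torsionH1OfDvd (W.quadraticTwist ((NumberField.discr K : ℤ) : ℚ)) K hdvd u',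
      SelmerDescent.hPsiKT_torsionH1OfDvd W hθ hd hdvd, hu', hu1]
    exact hx'
  have h2u' : (2 : ℤ) • u' = u := by
    apply hinjψ M
    change hPsiKT W K hθ hd ((2 ^ M : ℕ) : ℤ) (resTorsion (W.quadraticTwist ((NumberField.discr K : ℤ) : ℚ)) K ((2 ^ M : ℕ) : ℤ) ((2 : ℤ) • u')) =
      hPsiKT W K hθ hd ((2 ^ M : ℕ) : ℤ) (resTorsion (W.quadraticTwist ((NumberField.discr K : ℤ) : ℚ)) K ((2 ^ M : ℕ) : ℤ) u)
    rw [map_zsmul, map_zsmul, hu', hu, h2x']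
  have hu'fin : ∀ v' : HeightOneSpectrum (𝓞 ℚ), v' ≠ vℓ →
      u' ∈ selmerLocalKer (W.quadraticTwist ((NumberField.discr K : ℤ) : ℚ)) (v'.adicCompletion ℚ) ((2 ^ M : ℕ) : ℤ) := by
    intro v' hv'
    obtain ⟨u1', hu1', hsel⟩ := SelmerDescent.exists_twin_descent_kolyvaginClass_two_mem_selmerLocalKer_of_margin W hsurN hT K hIQ h2 hθ
      hd h3 hD4 hHe Dt β ι (M + 1) hc' hkM2 d' (htorsK (M + 1 + 1)) hx2neg hx1neg v' (haway v' hv')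
    have huu : u1' = u1 := hinjψ (M + 1) (hu1'.trans hu1.symm)
    rw [VisiblePairAtTwo.torsionH1OfDvd_mem_selmerLocalKer_iff (W.quadraticTwist ((NumberField.discr K : ℤ) : ℚ)) (v'.adicCompletion ℚ) hdvd u',
      hιu', ← huu]
    exact hsel
  have hu'inf : ∀ w' : InfinitePlace ℚ, u' ∈ selmerLocalKer (W.quadraticTwist ((NumberField.discr K : ℤ) : ℚ)) w'.Completion ((2 ^ M : ℕ) : ℤ) := by
    intro w'
    rw [VisiblePairAtTwo.torsionH1OfDvd_mem_selmerLocalKer_iff (W.quadraticTwist ((NumberField.discr K : ℤ) : ℚ)) w'.Completion hdvd u', hιu']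
    exact SelmerDescent.mem_selmerLocalKer_infinitePlace_twin_of_hPsiKT_resTorsion_eq_kolyvaginClass_two_of_margin W hsurN K hIQ h2 hθ hd h3 hD4
      hHe Dt β ι (M + 1) hc' hkM2 d' (htorsK (M + 1 + 1)) hx2neg hu1 w'
  have hu'dv : ((2 : ℤ) ^ κ) • u' ∉ selmerLocalKer (W.quadraticTwist ((NumberField.discr K : ℤ) : ℚ)) (vℓ.adicCompletion ℚ) ((2 ^ M : ℕ) : ℤ) := by
    have hk : ((2 : ℤ) ^ κ) • u' = ((2 : ℤ) ^ (κ - 1)) • u := by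
      rw [← h2u', smul_smul, ← pow_succ, Nat.sub_add_cancel hκ1]
    rw [hk]
    exact hudv
  have hdual := Engine.lemma_5_3_rat_two_quadraticTwist_regular W h2 hodd hM (q := 2 ^ M) rfl hℓ2 hℓdK hgood hℓv hreg2 hidxM hs₀
    hu'fin hu'inf hu'dv
  have hdualK : ((2 : ℤ) ^ (M - 1 - κ)) • resTorsion (W.quadraticTwist ((NumberField.discr K : ℤ) : ℚ)) K ((2 ^ M : ℕ) : ℤ) s₀ ∈
      ((W.quadraticTwist ((NumberField.discr K : ℤ) : ℚ)).baseChange K).torsionLocalKer (w.adicCompletion K) ((2 ^ M : ℕ) : ℤ) :=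
    (Engine.zsmul_mem_torsionLocalKer_iff_resTorsion_of_notMem_regular (W.quadraticTwist ((NumberField.discr K : ℤ) : ℚ)) hM (q := 2 ^ M) rfl
      hℓp hℓ2 hℓv hgoodTv h2 (not_mem_range hθ) hd hdKv hregMT w hf s₀ ((2 : ℤ) ^ (M - 1 - κ))).mp hdual
  have hdualW : ((2 : ℤ) ^ (M - 1 - κ)) • s ∈ (W.baseChange K).torsionLocalKer (w.adicCompletion K) ((2 ^ M : ℕ) : ℤ) :=
    (EigenClassesFinite.zsmul_mem_torsionLocalKer_iff_hPsiKT_mem W K hθ hd ((2 ^ M : ℕ) : ℤ) (w.adicCompletion K) _ _).mp hdualK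
  have hdualW' : ((2 ^ (M - 1 - κ) : ℕ) : ℤ) • s ∈ (W.baseChange K).torsionLocalKer (w.adicCompletion K) ((2 ^ M : ℕ) : ℤ) := by
    exact_mod_cast hdualW
  -- ### conclusion: `a ≤ M − 1 − κ ≤ M₀ − 1`, contradicting `2^{M₀−1} • s₀ ≠ 0`
  have haMκ : a ≤ M - 1 - κ := (hαs (M - 1 - κ)).mp hdualW'
  have haM₀ : a ≤ M₀ - 1 := by omega
  have hs0 : ((2 ^ (M₀ - 1) : ℕ) : ℤ) • s = 0 := (two_pow_zsmul_eq_zero_iff_of_addOrderOf W K ha (M₀ - 1)).mpr haM₀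
  apply hne
  apply hinjψ M
  change hPsiKT W K hθ hd ((2 ^ M : ℕ) : ℤ) (resTorsion (W.quadraticTwist ((NumberField.discr K : ℤ) : ℚ)) K ((2 ^ M : ℕ) : ℤ)
      (((2 ^ (M₀ - 1) : ℕ) : ℤ) • s₀)) =
    hPsiKT W K hθ hd ((2 ^ M : ℕ) : ℤ) (resTorsion (W.quadraticTwist ((NumberField.discr K : ℤ) : ℚ)) K ((2 ^ M : ℕ) : ℤ) 0)
  rw [map_zsmul, map_zsmul, map_zero, map_zero]
  exact hs0

end Summit.BirchSwinnertonDyer.BirchSwinnertonDyer.Theorems.GenusExact.TwinSwap.TwinAnnihilation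

end
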